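import Literature.Probability.Percolation.ArmSeparationExclusion
import HarnessLib

/-!
# Same-colour tip spacing, inner ring: isolating the fence zone of a lowest crossing, at `p`

Topic `Literature/Probability/Percolation`; family `crit-perc` / near-critical percolation on `𝕋`
(`P_p = triSitePercolation p`, any `p`). Continuation of `ArmSeparationExclusion.lean` (a brick of
the near-critical arm-separation theorem for four arms in the ADJACENT colour arrangement,
P. Nolin, EJP 13 (2008), Thm. 11, `j = 4`, `σ = BBWW` [arXiv 0711.4948: Thm. 10]; the last missing
input `hsepAdj` of `Werner2009_lemma63_of_altSeparation_of_adjSeparation`). The outer ring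
`{17k ≤ ‖·-z‖_∞ ≤ 31k}` of that file keeps long open paths above the `u`-th lowest crossing `c_u`
away from its tip `z_u`; the fence of `c_u` at scale `k` however lives in the box
`{‖·-z_u‖_∞ ≤ 2k+1}` (`trapFrameZone`), and the rerouting of a same-colour PAIR
(`TriLowestCrossingReroute.lean`) must keep the other arm out of that zone. This file adds a second,
INNER closed ring in the free window `{3k ≤ ‖·-z‖_∞ ≤ 7k}` between the fence frame (`{k ≤ ‖·‖ ≤ 2k}`)
and the protection frame (`{8k ≤ ‖·‖ ≤ 16k}`) of `trapRSW z k`: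

* `triInnerRingAt z k` — the four strips of `{3k ≤ ‖· - z‖_∞ ≤ 7k}` crossed the long way (aspect
  ratio `14/4`); `le_real_triInnerRingAt_of_rsw`; `not_pathIn_of_closed_innerRing` — a closed inner
  ring about `z` present off a frozen set `L` blocks every open path avoiding `L` from the box
  `{‖·-z‖_∞ ≤ 3k}` to the outside of `{‖·-z‖_∞ < 7k}`;
* `determinedBy_trapRSW_fine` — `trapRSW z k` only depends on the two frame annuli
  `{k ≤ ‖·‖ ≤ 2k} ∪ {8k ≤ ‖·‖ ≤ 16k}`; `trapRSW₃ z k := trapRSW₂ z k ∩ compl ⁻¹' triInnerRingAt z k`,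
  `real_trapRSW₃_ge_at` (`≥ c_F² c_E c_I`, three pairwise disjoint supports);
* `TrapFenceOK₃` (fence, protection, outer AND inner exclusion), `trapFenceOK₃_of_mem_trapRSW₃`,
  `TrapSeqFail₃`, `TrapNoRSW₃`, `determinedBy_trapNoRSW₃`, `trapNoRSW₃_of_fail`, `trapNoRSW₃_subset`,
  `real_iInter_compl_trapRSW₃_le_at`, `real_trapSeqFail₃_le_at` (`≤ P_p(lowestSeq u ≠ none) (1 - c_F² c_E c_I)^K`).

Everything here is proved; no named facts are introduced.

## References

* P. Nolin, Near-critical percolation in two dimensions, *Electron. J. Probab.* 13 (2008), §4.4,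
  proof of Lemma 15 (arXiv 0711.4948: Lemma 14, (4.18)–(4.19)), with Thm. 11 "uniformly in `p`" [Nolin2008].
* H. Kesten, Scaling relations for 2D-percolation, *Comm. Math. Phys.* 109 (1987), Lemma 2 [Kesten1987].
* G. Grimmett, *Percolation*, 2nd ed. (1999), §11.7–11.8 (RSW frames) [GrimmettPercolation1999].

Tree: everything of `ArmSeparationExclusion.lean` (`triRingAt`, `trapRSW₂`, `TrapFenceOK₂`,
`trapFenceOK₂_of_mem_trapRSW₂`, `trapScalesFinset₂`, `disjoint_trapScalesFinset₂`,
`determinedBy_compl_preimage_triRingAt`, `real_trapRSW₂_ge_at`), `ArmSeparationFenceBound(At).lean`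
(`trapRSW`, `determinedBy_triFrameAt`, `sq_le_real_trapRSW_at`, `trapPairs`, …),
`TriLowestCrossing.lean`, `TriRSWChaining.lean`, `TriPathCrossings.lean`
(`PathIn.meets_annulus_crossings`); `sitePercolation_harris`, `sitePercolation_real_inter_of_disjoint`,
`sitePercolation_real_preimage_compl`, `DeterminedBy.compl`.
-/

noncomputable section

open MeasureTheory Set

namespace Literature.Probability.Percolation

open LatticeModels

/-! ### The inner ring about a site -/

/-- **The open inner ring at scale `k` about `z`**: the four strips
`[z₀-7k, z₀+7k] × [z₁+3k, z₁+7k]`, `[z₀-7k, z₀+7k] × [z₁-7k, z₁-3k]` (crossed horizontally) and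
`[z₀-7k, z₀-3k] × [z₁-7k, z₁+7k]`, `[z₀+3k, z₀+7k] × [z₁-7k, z₁+7k]` (crossed vertically) of the
square annulus `{3k ≤ ‖· - z‖_∞ ≤ 7k}` are each crossed the long way by open sites. [cite: Nolin2008, §4.4 Lemma 15 (proof) (arXiv 0711.4948: Lemma 14, the annuli about z_u)] -/
def triInnerRingAt (z : Site 2) (k : ℕ) : Set (SiteConfig (Site 2)) :=
  (triHCross (z 0 - 7 * k) (z 1 + 3 * k) (14 * k) (4 * k) ∩ triHCross (z 0 - 7 * k) (z 1 - 7 * k) (14 * k) (4 * k)) ∩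
    (triVCross (z 0 - 7 * k) (z 1 - 7 * k) (4 * k) (14 * k) ∩ triVCross (z 0 + 3 * k) (z 1 - 7 * k) (4 * k) (14 * k))

/-- The ring at scale `k` is determined by the square annulus `{3k ≤ ‖· - z‖_∞ ≤ 7k}`. [folklore] -/
theorem determinedBy_triInnerRingAt (z : Site 2) (k : ℕ) :
    DeterminedBy (triInnerRingAt z k) ↑(triSqAnnulusFinset z (3 * k) (7 * k)) := by
  have sub : ∀ (a b : ℤ) (m n : ℕ), (∀ v : Site 2, v ∈ triStrip a b m n → v ∈ triSqAnnulusFinset z (3 * k) (7 * k)) →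
      (↑(triStripFinset a b m n) : Set (Site 2)) ⊆ ↑(triSqAnnulusFinset z (3 * k) (7 * k)) := by
    intro a b m n h v hv
    rw [coe_triStripFinset] at hv
    exact Finset.mem_coe.2 (h v hv)
  refine ((((determinedBy_triHCross _ _ _ _).mono (sub _ _ _ _ fun v hv => ?_)).inter
    ((determinedBy_triHCross _ _ _ _).mono (sub _ _ _ _ fun v hv => ?_))).inter
    (((determinedBy_triVCross _ _ _ _).mono (sub _ _ _ _ fun v hv => ?_)).inter
    ((determinedBy_triVCross _ _ _ _).mono (sub _ _ _ _ fun v hv => ?_)))) <;>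
  · rw [mem_triStrip] at hv
    rw [mem_triSqAnnulusFinset]
    push_cast at hv ⊢
    omega

/-- The closed-ring event is determined by the same annulus. [folklore] -/
theorem determinedBy_compl_preimage_triInnerRingAt (z : Site 2) (k : ℕ) :
    DeterminedBy (compl ⁻¹' triInnerRingAt z k) ↑(triSqAnnulusFinset z (3 * k) (7 * k)) := by
  have h := determinedBy_triInnerRingAt z k
  rw [determinedBy_iff] at h ⊢
  intro ω ω' hω
  rw [Set.mem_preimage, Set.mem_preimage]
  apply h
  ext v
  simp only [Set.mem_inter_iff, Set.mem_compl_iff]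
  have key := Set.ext_iff.1 hω v
  simp only [Set.mem_inter_iff] at key
  constructor
  · rintro ⟨hv, hvS⟩
    exact ⟨fun hv' => hv (key.2 ⟨hv', hvS⟩).1, hvS⟩
  · rintro ⟨hv, hvS⟩
    exact ⟨fun hv' => hv (key.1 ⟨hv', hvS⟩).1, hvS⟩

/-- The ring event is increasing. [folklore] -/
theorem isUpperSet_triInnerRingAt (z : Site 2) (k : ℕ) : IsUpperSet (triInnerRingAt z k) :=
  ((isUpperSet_triHCross _ _ _ _).inter (isUpperSet_triHCross _ _ _ _)).inter
    ((isUpperSet_triVCross _ _ _ _).inter (isUpperSet_triVCross _ _ _ _))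

/-- The ring event is measurable. [folklore] -/
theorem measurableSet_triInnerRingAt (z : Site 2) (k : ℕ) : MeasurableSet (triInnerRingAt z k) :=
  (determinedBy_triInnerRingAt z k).measurableSet_of_finset

/-- **RSW for rings, at density `q`**: `c ≤ P_q(LR(14k, 4k))` gives `c⁴ ≤ P_q(triInnerRingAt z k)`
(Harris' inequality multiplies the four long-way crossing probabilities). [cite: Nolin2008, §4.4 Lemma 15 (proof) (arXiv 0711.4948: Lemma 14), with Thm. 11 "uniformly in p"] -/
theorem le_real_triInnerRingAt_of_rsw (q : unitInterval) {c : ℝ} (hc0 : 0 ≤ c) (z : Site 2) (k : ℕ)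
    (hck : c ≤ triLRCrossingProb q (14 * k) (4 * k)) :
    c ^ 4 ≤ (triSitePercolation q).real (triInnerRingAt z k) := by
  set F := triSqAnnulusFinset z (3 * k) (7 * k)
  have sub : ∀ (a b : ℤ) (m n : ℕ), (∀ v : Site 2, v ∈ triStrip a b m n → v ∈ F) →
      (↑(triStripFinset a b m n) : Set (Site 2)) ⊆ ↑F := by
    intro a b m n h v hv
    rw [coe_triStripFinset] at hv
    exact Finset.mem_coe.2 (h v hv)
  have d1 : DeterminedBy (triHCross (z 0 - 7 * k) (z 1 + 3 * k) (14 * k) (4 * k)) ↑F :=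
    (determinedBy_triHCross _ _ _ _).mono (sub _ _ _ _ fun v hv => by
      rw [mem_triStrip] at hv; rw [mem_triSqAnnulusFinset]; push_cast at hv ⊢; omega)
  have d2 : DeterminedBy (triHCross (z 0 - 7 * k) (z 1 - 7 * k) (14 * k) (4 * k)) ↑F :=
    (determinedBy_triHCross _ _ _ _).mono (sub _ _ _ _ fun v hv => by
      rw [mem_triStrip] at hv; rw [mem_triSqAnnulusFinset]; push_cast at hv ⊢; omega)
  have d3 : DeterminedBy (triVCross (z 0 - 7 * k) (z 1 - 7 * k) (4 * k) (14 * k)) ↑F :=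
    (determinedBy_triVCross _ _ _ _).mono (sub _ _ _ _ fun v hv => by
      rw [mem_triStrip] at hv; rw [mem_triSqAnnulusFinset]; push_cast at hv ⊢; omega)
  have d4 : DeterminedBy (triVCross (z 0 + 3 * k) (z 1 - 7 * k) (4 * k) (14 * k)) ↑F :=
    (determinedBy_triVCross _ _ _ _).mono (sub _ _ _ _ fun v hv => by
      rw [mem_triStrip] at hv; rw [mem_triSqAnnulusFinset]; push_cast at hv ⊢; omega)
  have u1 := isUpperSet_triHCross (z 0 - 7 * k) (z 1 + 3 * k) (14 * k) (4 * k)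
  have u2 := isUpperSet_triHCross (z 0 - 7 * k) (z 1 - 7 * k) (14 * k) (4 * k)
  have u3 := isUpperSet_triVCross (z 0 - 7 * k) (z 1 - 7 * k) (4 * k) (14 * k)
  have u4 := isUpperSet_triVCross (z 0 + 3 * k) (z 1 - 7 * k) (4 * k) (14 * k)
  have e1 := triSitePercolation_real_triHCross q (z 0 - 7 * k) (z 1 + 3 * k) (14 * k) (4 * k)
  have e2 := triSitePercolation_real_triHCross q (z 0 - 7 * k) (z 1 - 7 * k) (14 * k) (4 * k)
  have e3 := triSitePercolation_real_triVCross q (z 0 - 7 * k) (z 1 - 7 * k) (4 * k) (14 * k)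
  have e4 := triSitePercolation_real_triVCross q (z 0 + 3 * k) (z 1 - 7 * k) (4 * k) (14 * k)
  have hH := sitePercolation_harris q d1 d2 u1 u2
  have hV := sitePercolation_harris q d3 d4 u3 u4
  have hHV := sitePercolation_harris q (d1.inter d2) (d3.inter d4) (u1.inter u2) (u3.inter u4)
  unfold triSitePercolation at e1 e2 e3 e4 ⊢
  rw [e1, e2] at hH
  rw [e3, e4] at hV
  have h0 : 0 ≤ triLRCrossingProb q (14 * k) (4 * k) := measureReal_nonneg
  calc c ^ 4 ≤ triLRCrossingProb q (14 * k) (4 * k) ^ 4 := by gcongr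
    _ = (triLRCrossingProb q (14 * k) (4 * k) * triLRCrossingProb q (14 * k) (4 * k)) *
          (triLRCrossingProb q (14 * k) (4 * k) * triLRCrossingProb q (14 * k) (4 * k)) := by ring
    _ ≤ _ := (mul_le_mul hH hV (mul_nonneg h0 h0) measureReal_nonneg).trans hHV

/-- **Closed rings at `p` are open rings at `1 - p`**: `P_p(compl ⁻¹' triInnerRingAt z k) = P_{1-p}(triInnerRingAt z k)`. [folklore] -/
theorem real_compl_preimage_triInnerRingAt (p : unitInterval) (z : Site 2) (k : ℕ) :
    (triSitePercolation p).real (compl ⁻¹' triInnerRingAt z k) = (triSitePercolation (unitInterval.symm p)).real (triInnerRingAt z k) := by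
  unfold triSitePercolation
  exact sitePercolation_real_preimage_compl p _

/-! ### Deterministic exclusion -/

/-- **A closed ring about `z`, present off a frozen set `L`, blocks every open path avoiding `L`
across its annulus.** If `ω'` agrees with `ω` off `L` and the ring at scale `k ≥ 1` about `z` is
closed in `ω'`, then no `ω`-open `𝕋`-path all of whose sites avoid `L` joins a site of the box
`{‖· - z‖_∞ ≤ 3k}` to a site outside `{‖· - z‖_∞ < 7k}`: such a path meets one of the four ring
crossings (`PathIn.meets_annulus_crossings`) at a site closed in `ω'`, off `L` hence closed in `ω`,
but open in `ω`. (With `L = lower c_u z_u`: open paths of `above c_u` entering the fence zone of `c_u` come from within `7k`.) [cite: Nolin2008, §4.4 Lemma 15 (proof) (arXiv 0711.4948: Lemma 14)] -/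
theorem not_pathIn_of_closed_innerRing {z : Site 2} {k : ℕ} (hk : 1 ≤ k) {L A : Set (Site 2)}
    {ω ω' : SiteConfig (Site 2)} (hagree : ∀ v, v ∉ L → (v ∈ ω' ↔ v ∈ ω)) (hring : ω'ᶜ ∈ triInnerRingAt z k)
    (hA : A ⊆ Lᶜ ∩ ω) {s t : Site 2}
    (hs : z 0 - 3 * k ≤ s 0 ∧ s 0 ≤ z 0 + 3 * k ∧ z 1 - 3 * k ≤ s 1 ∧ s 1 ≤ z 1 + 3 * k)
    (ht : t 0 ≤ z 0 - 7 * k ∨ z 0 + 7 * k ≤ t 0 ∨ t 1 ≤ z 1 - 7 * k ∨ z 1 + 7 * k ≤ t 1) :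
    ¬ PathIn triGraph A s t := by
  intro hP
  obtain ⟨⟨⟨xN, yN, hxN, hyN, hN⟩, ⟨xS, yS, hxS, hyS, hS⟩⟩, ⟨⟨xW, yW, hxW, hyW, hW⟩, ⟨xE, yE, hxE, hyE, hE⟩⟩⟩ := hring
  have hk' : (1 : ℤ) ≤ k := by exact_mod_cast hk
  -- the ring crossings, inside the closed set `ω'ᶜ`
  set K : Set (Site 2) := triSqAnnulusFinset z (3 * k) (7 * k) ∩ ω'ᶜ with hK
  have strip_sub : ∀ {a b : ℤ} {m n : ℕ} {v : Site 2}, v ∈ triStrip a b m n ∩ ω'ᶜ →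
      (z 0 - 7 * k ≤ a) → (a + m ≤ z 0 + 7 * k) → (z 1 - 7 * k ≤ b) → (b + n ≤ z 1 + 7 * k) →
      (a + m ≤ z 0 - 3 * k ∨ z 0 + 3 * k ≤ a ∨ b + n ≤ z 1 - 3 * k ∨ z 1 + 3 * k ≤ b) → v ∈ K := by
    intro a b m n v hv h1 h2 h3 h4 h5
    rw [Set.mem_inter_iff, mem_triStrip] at hv
    refine ⟨Finset.mem_coe.2 (mem_triSqAnnulusFinset.2 ⟨⟨?_, ?_, ?_, ?_⟩, ?_⟩), hv.2⟩ <;> omega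
  have hKb : ∀ v ∈ K, z 0 - 7 * k ≤ v 0 ∧ v 0 ≤ z 0 + 7 * k ∧ z 1 - 7 * k ≤ v 1 ∧ v 1 ≤ z 1 + 7 * k := by
    intro v hv
    have h := (mem_triSqAnnulusFinset.1 (Finset.mem_coe.1 hv.1)).1
    push_cast at h
    omega
  have htop : ∃ u v, u 0 = z 0 - 7 * k ∧ v 0 = z 0 + 7 * k ∧ PathIn triGraph (K ∩ {w | z 1 + 3 * k ≤ w 1}) u v := by
    refine ⟨xN, yN, hxN, by rw [hyN]; push_cast; ring, hN.mono fun v hv => ⟨?_, ?_⟩⟩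
    · exact strip_sub hv (by omega) (by push_cast; omega) (by omega) (by push_cast; omega) (by omega)
    · have := (mem_triStrip.1 hv.1).2.2.1; exact this
  have hbot : ∃ u v, u 0 = z 0 - 7 * k ∧ v 0 = z 0 + 7 * k ∧ PathIn triGraph (K ∩ {w | w 1 ≤ z 1 - 3 * k}) u v := by
    refine ⟨xS, yS, hxS, by rw [hyS]; push_cast; ring, hS.mono fun v hv => ⟨?_, ?_⟩⟩
    · exact strip_sub hv (by omega) (by push_cast; omega) (by omega) (by push_cast; omega) (by push_cast; omega)
    · have := (mem_triStrip.1 hv.1).2.2.2; show v 1 ≤ z 1 - 3 * k; push_cast at this; omega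
  have hleft : ∃ u v, u 1 = z 1 - 7 * k ∧ v 1 = z 1 + 7 * k ∧ PathIn triGraph (K ∩ {w | w 0 ≤ z 0 - 3 * k}) u v := by
    refine ⟨xW, yW, hxW, by rw [hyW]; push_cast; ring, hW.mono fun v hv => ⟨?_, ?_⟩⟩
    · exact strip_sub hv (by omega) (by push_cast; omega) (by omega) (by push_cast; omega) (by push_cast; omega)
    · have := (mem_triStrip.1 hv.1).2.1; show v 0 ≤ z 0 - 3 * k; push_cast at this; omega
  have hright : ∃ u v, u 1 = z 1 - 7 * k ∧ v 1 = z 1 + 7 * k ∧ PathIn triGraph (K ∩ {w | z 0 + 3 * k ≤ w 0}) u v := by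
    refine ⟨xE, yE, hxE, by rw [hyE]; push_cast; ring, hE.mono fun v hv => ⟨?_, ?_⟩⟩
    · exact strip_sub hv (by omega) (by push_cast; omega) (by omega) (by push_cast; omega) (by omega)
    · have := (mem_triStrip.1 hv.1).1; exact this
  obtain ⟨x, hxA, hxK⟩ := PathIn.meets_annulus_crossings (A := A) (K := K)
    (L₂ := z 0 - 7 * k) (L₁ := z 0 - 3 * k) (R₁ := z 0 + 3 * k) (R₂ := z 0 + 7 * k)
    (B₂ := z 1 - 7 * k) (B₁ := z 1 - 3 * k) (T₁ := z 1 + 3 * k) (T₂ := z 1 + 7 * k)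
    (by omega) (by omega) (by omega) (by omega) hKb htop hbot hleft hright hs ht hP
  -- `x` is open in `ω`, off `L`, hence open in `ω'`; but it is on the closed ring of `ω'`
  have hx := hA hxA
  exact hxK.2 ((hagree x hx.1).2 hx.2)

/-! ### The per-scale RSW event with both exclusions -/

/-- **`trapRSW z k` only depends on the two frame annuli** `{k ≤ ‖·-z‖_∞ ≤ 2k}` and
`{8k ≤ ‖·-z‖_∞ ≤ 16k}`. [folklore] -/
theorem determinedBy_trapRSW_fine (z : Site 2) (k : ℕ) :
    DeterminedBy (trapRSW z k) ↑(triSqAnnulusFinset z k (2 * k) ∪ triSqAnnulusFinset z (8 * k) (16 * k)) := by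
  rw [Finset.coe_union]
  refine ((determinedBy_triFrameAt z k).mono Set.subset_union_left).inter ((determinedBy_triFrameAt z (8 * k)).mono ?_)
  intro v hv
  right
  rw [Finset.mem_coe, mem_triSqAnnulusFinset] at hv ⊢
  push_cast at hv ⊢
  omega

/-- **The per-scale RSW event with both exclusions**: `trapRSW₂ z k` (frames at `k`, `8k`; closed
outer ring) and a CLOSED inner ring in `{3k ≤ ‖·-z‖_∞ ≤ 7k}`. [cite: Nolin2008, §4.4 Lemma 15 (proof) (arXiv 0711.4948: Lemma 14)] -/
def trapRSW₃ (z : Site 2) (k : ℕ) : Set (SiteConfig (Site 2)) := trapRSW₂ z k ∩ compl ⁻¹' triInnerRingAt z k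

/-- `trapRSW₃ z k` is determined by the square annulus `{k ≤ ‖·-z‖_∞ ≤ 31k}`. [folklore] -/
theorem determinedBy_trapRSW₃ (z : Site 2) (k : ℕ) : DeterminedBy (trapRSW₃ z k) ↑(triSqAnnulusFinset z k (31 * k)) := by
  refine ((determinedBy_trapRSW₂ z k).mono subset_rfl).inter ((determinedBy_compl_preimage_triInnerRingAt z k).mono ?_)
  intro v hv
  rw [Finset.mem_coe, mem_triSqAnnulusFinset] at hv ⊢; push_cast at hv ⊢; omega

/-- `trapRSW₃ z k` is measurable. [folklore] -/
theorem measurableSet_trapRSW₃ (z : Site 2) (k : ℕ) : MeasurableSet (trapRSW₃ z k) :=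
  (determinedBy_trapRSW₃ z k).measurableSet_of_finset

/-- **`P_p(trapRSW₃ z k) ≥ c_F² c_E c_I`**: the frames (`{k..2k} ∪ {8k..16k}`), the outer ring
(`{17k..31k}`) and the inner ring (`{3k..7k}`) are determined by pairwise disjoint annuli (`k ≥ 1`). [cite: Nolin2008, §4.4 Lemma 15 (proof) (arXiv 0711.4948: Lemma 14), with Thm. 11 "uniformly in p"] -/
theorem real_trapRSW₃_ge_at (p : unitInterval) {cF cE cI : ℝ} (hcF : 0 < cF) (hcE : 0 ≤ cE) (hcI : 0 ≤ cI) (z : Site 2)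
    {k : ℕ} (hk : 1 ≤ k) (h1 : cF ≤ (triSitePercolation p).real (triFrameAt z k))
    (h8 : cF ≤ (triSitePercolation p).real (triFrameAt z (8 * k)))
    (hE : cE ≤ (triSitePercolation p).real (compl ⁻¹' triRingAt z k))
    (hI : cI ≤ (triSitePercolation p).real (compl ⁻¹' triInnerRingAt z k)) :
    cF ^ 2 * cE * cI ≤ (triSitePercolation p).real (trapRSW₃ z k) := by
  have hsq := sq_le_real_trapRSW_at p hcF z k h1 h8
  -- frames and outer ring
  have d12 : Disjoint (triSqAnnulusFinset z k (2 * k) ∪ triSqAnnulusFinset z (8 * k) (16 * k))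
      (triSqAnnulusFinset z (17 * k) (31 * k)) := by
    rw [Finset.disjoint_left]
    intro v hv hv'
    rw [Finset.mem_union, mem_triSqAnnulusFinset, mem_triSqAnnulusFinset] at hv
    rw [mem_triSqAnnulusFinset] at hv'
    push_cast at hv hv'
    omega
  have h2 : cF ^ 2 * cE ≤ (triSitePercolation p).real (trapRSW₂ z k) := by
    unfold triSitePercolation at hsq hE ⊢
    rw [trapRSW₂, sitePercolation_real_inter_of_disjoint p (determinedBy_trapRSW_fine z k)
      (determinedBy_compl_preimage_triRingAt z k) d12]
    exact mul_le_mul hsq hE hcE measureReal_nonneg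
  -- `trapRSW₂` versus the inner ring
  have d2 : DeterminedBy (trapRSW₂ z k) ↑(triSqAnnulusFinset z k (2 * k) ∪ triSqAnnulusFinset z (8 * k) (16 * k) ∪
      triSqAnnulusFinset z (17 * k) (31 * k)) := by
    rw [Finset.coe_union]
    exact ((determinedBy_trapRSW_fine z k).mono Set.subset_union_left).inter
      ((determinedBy_compl_preimage_triRingAt z k).mono Set.subset_union_right)
  have d23 : Disjoint (triSqAnnulusFinset z k (2 * k) ∪ triSqAnnulusFinset z (8 * k) (16 * k) ∪ triSqAnnulusFinset z (17 * k) (31 * k))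
      (triSqAnnulusFinset z (3 * k) (7 * k)) := by
    rw [Finset.disjoint_left]
    intro v hv hv'
    rw [Finset.mem_union, Finset.mem_union, mem_triSqAnnulusFinset, mem_triSqAnnulusFinset, mem_triSqAnnulusFinset] at hv
    rw [mem_triSqAnnulusFinset] at hv'
    push_cast at hv hv'
    omega
  unfold triSitePercolation at h2 hI ⊢
  rw [trapRSW₃, sitePercolation_real_inter_of_disjoint p d2 (determinedBy_compl_preimage_triInnerRingAt z k) d23]
  exact mul_le_mul h2 hI hcI measureReal_nonneg

/-! ### Independent scales -/

/-- **Independent scales at density `p`, with both exclusions**: frames `≥ c_F` at scales `< S`,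
closed outer rings `≥ c_E` and closed inner rings `≥ c_I` at scales `1 ≤ k < S'`; then along
`k_j = k₀ · 32^j`, `j < K` (`8k_j < S`, `k_j < S'`):
`P_p(⋂_{j<K} (trapRSW₃ z k_j)ᶜ) ≤ (1 - c_F² c_E c_I)^K`, determined by the wide annuli. [cite: Nolin2008, §4.4 Lemma 15 (proof) (arXiv 0711.4948: Lemma 14, (4.18)), with Thm. 11 "uniformly in p"] -/
theorem real_iInter_compl_trapRSW₃_le_at (p : unitInterval) {cF cE cI : ℝ} (hcF : 0 < cF) (hcE : 0 ≤ cE) (hcI : 0 ≤ cI)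
    {S S' : ℕ}
    (hF : ∀ (z : Site 2) (k : ℕ), 1 ≤ k → k < S → cF ≤ (triSitePercolation p).real (triFrameAt z k))
    (hEr : ∀ (z : Site 2) (k : ℕ), 1 ≤ k → k < S' → cE ≤ (triSitePercolation p).real (compl ⁻¹' triRingAt z k))
    (hIr : ∀ (z : Site 2) (k : ℕ), 1 ≤ k → k < S' → cI ≤ (triSitePercolation p).real (compl ⁻¹' triInnerRingAt z k))
    (z : Site 2) {k₀ : ℕ} (hk₀ : 1 ≤ k₀) :
    ∀ K : ℕ, (∀ j < K, 8 * trapScale k₀ j < S) → (∀ j < K, trapScale k₀ j < S') →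
      (triSitePercolation p).real (⋂ j ∈ Finset.range K, (trapRSW₃ z (trapScale k₀ j))ᶜ) ≤ (1 - cF ^ 2 * cE * cI) ^ K ∧
        DeterminedBy (⋂ j ∈ Finset.range K, (trapRSW₃ z (trapScale k₀ j))ᶜ) ↑(trapScalesFinset₂ z k₀ K)
  | 0 => fun _ _ => by
    constructor
    · simp
    · simp only [Finset.range_zero, Finset.notMem_empty, Set.iInter_of_empty, Set.iInter_univ]
      exact determinedBy_univ _
  | K + 1 => fun hKS hKS' => by
    obtain ⟨ihle, ihdet⟩ := real_iInter_compl_trapRSW₃_le_at p hcF hcE hcI hF hEr hIr z hk₀ K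
      (fun j hj => hKS j (Nat.lt_succ_of_lt hj)) (fun j hj => hKS' j (Nat.lt_succ_of_lt hj))
    have hsplit : (⋂ j ∈ Finset.range (K + 1), (trapRSW₃ z (trapScale k₀ j))ᶜ) =
        (⋂ j ∈ Finset.range K, (trapRSW₃ z (trapScale k₀ j))ᶜ) ∩ (trapRSW₃ z (trapScale k₀ K))ᶜ := by
      rw [Finset.range_add_one, Finset.set_biInter_insert, Set.inter_comm]
    have hdetK : DeterminedBy (trapRSW₃ z (trapScale k₀ K))ᶜ ↑(triSqAnnulusFinset z (trapScale k₀ K) (31 * trapScale k₀ K)) :=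
      (determinedBy_trapRSW₃ z (trapScale k₀ K)).compl
    have hK8 : 8 * trapScale k₀ K < S := hKS K (Nat.lt_succ_self K)
    have hKS1 : trapScale k₀ K < S' := hKS' K (Nat.lt_succ_self K)
    have hK1 : 1 ≤ trapScale k₀ K := one_le_trapScale hk₀ K
    constructor
    · rw [hsplit]
      unfold triSitePercolation at ihle hF hEr hIr ⊢
      rw [sitePercolation_real_inter_of_disjoint p ihdet hdetK (disjoint_trapScalesFinset₂ hk₀ z K)]
      have hc : (sitePercolation (Site 2) p).real (trapRSW₃ z (trapScale k₀ K))ᶜ ≤ 1 - cF ^ 2 * cE * cI := by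
        rw [measureReal_compl (measurableSet_trapRSW₃ _ _), probReal_univ]
        have := real_trapRSW₃_ge_at p hcF hcE hcI z hK1 (hF z _ hK1 (by omega)) (hF z _ (by omega) (by omega))
          (hEr z _ hK1 hKS1) (hIr z _ hK1 hKS1)
        unfold triSitePercolation at this
        linarith
      have h1 : 0 ≤ 1 - cF ^ 2 * cE * cI := le_trans measureReal_nonneg hc
      rw [pow_succ]
      exact mul_le_mul ihle hc measureReal_nonneg (pow_nonneg h1 K)
    · rw [hsplit]
      refine (ihdet.mono ?_).inter (hdetK.mono ?_)
      · intro v hv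
        rw [Finset.mem_coe, trapScalesFinset₂, Finset.mem_biUnion] at hv ⊢
        obtain ⟨j, hj, hv⟩ := hv
        exact ⟨j, Finset.mem_range.2 (Nat.lt_succ_of_lt (Finset.mem_range.1 hj)), hv⟩
      · intro v hv
        rw [Finset.mem_coe, trapScalesFinset₂, Finset.mem_biUnion]
        exact ⟨K, Finset.self_mem_range_succ K, hv⟩

/-! ### The per-scale success event with both exclusions and the union bound -/

/-- **The fence of `c` at scale `k` succeeds in `ω`, with both exclusions**: `TrapFenceOK₂ M c z k ω`
AND no `ω`-open `𝕋`-path off `lower c z` joins the box `{‖· - z‖_∞ ≤ 3k}` to the outside of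
`{‖· - z‖_∞ < 7k}`. [cite: Nolin2008, §4.4 Lemma 15 (proof) (arXiv 0711.4948: Lemma 14)] -/
def TrapFenceOK₃ (M : ℕ) (c : Finset (Site 2)) (z : Site 2) (k : ℕ) (ω : SiteConfig (Site 2)) : Prop :=
  TrapFenceOK₂ M c z k ω ∧
    ∀ s t : Site 2, (z 0 - 3 * k ≤ s 0 ∧ s 0 ≤ z 0 + 3 * k ∧ z 1 - 3 * k ≤ s 1 ∧ s 1 ≤ z 1 + 3 * k) →
      (t 0 ≤ z 0 - 7 * k ∨ z 0 + 7 * k ≤ t 0 ∨ t 1 ≤ z 1 - 7 * k ∨ z 1 + 7 * k ≤ t 1) →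
      ¬ PathIn triGraph ((↑((trapDomain M).lower c z) : Set (Site 2))ᶜ ∩ ω) s t

/-- **One good configuration off `lower c z` suffices**, with both exclusions (`1 ≤ k`, `16k + 1 ≤ M`). [cite: Nolin2008, §4.4 Lemma 15 (proof) (arXiv 0711.4948: Lemma 14)] -/
theorem trapFenceOK₃_of_mem_trapRSW₃ {M k : ℕ} {c : Finset (Site 2)} {z : Site 2} (hk : 1 ≤ k)
    (hkM : 16 * (k : ℤ) + 1 ≤ M) (hc : (trapDomain M).IsCrossing c z) {ω ω' : SiteConfig (Site 2)}
    (hcω : (↑c : Set (Site 2)) ⊆ ω) (hagree : ∀ v, v ∉ (trapDomain M).lower c z → (v ∈ ω' ↔ v ∈ ω))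
    (hω' : ω' ∈ trapRSW₃ z k) : TrapFenceOK₃ M c z k ω := by
  refine ⟨trapFenceOK₂_of_mem_trapRSW₂ hk hkM hc hcω hagree hω'.1, fun s t hs ht => ?_⟩
  refine not_pathIn_of_closed_innerRing hk (L := ↑((trapDomain M).lower c z)) (fun v hv => hagree v ?_) ?_ subset_rfl hs ht
  · exact fun h => hv (Finset.mem_coe.2 h)
  · have : ω'ᶜ ∈ triInnerRingAt z k := hω'.2
    exact this

/-- **Failure of the `u`-th lowest crossing, with both exclusions.** [cite: Nolin2008, §4.4 Lemma 15 (proof) (arXiv 0711.4948: Lemma 14)] -/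
def TrapSeqFail₃ (M u k₀ K : ℕ) (ω : SiteConfig (Site 2)) : Prop :=
  ∃ c z, (trapDomain M).lowestSeq ω u = some (c, z) ∧ ∀ j < K, ¬ TrapFenceOK₃ M c z (trapScale k₀ j) ω

/-- `TrapNoRSW₃` — no configuration agreeing with `ω` off `lower c z` lies in any `trapRSW₃ z k_j`. [cite: Nolin2008, §4.4 Lemma 15 (proof) (arXiv 0711.4948: Lemma 14)] -/
def TrapNoRSW₃ (M : ℕ) (c : Finset (Site 2)) (z : Site 2) (k₀ K : ℕ) (ω : SiteConfig (Site 2)) : Prop :=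
  ∀ j < K, ∀ ω' : SiteConfig (Site 2), (∀ v, v ∉ (trapDomain M).lower c z → (v ∈ ω' ↔ v ∈ ω)) →
    ω' ∉ trapRSW₃ z (trapScale k₀ j)

/-- `TrapNoRSW₃` is determined by the sites of the wide annuli that are off `lower c z`. [folklore] -/
theorem determinedBy_trapNoRSW₃ (M : ℕ) (c : Finset (Site 2)) (z : Site 2) (k₀ K : ℕ) :
    DeterminedBy {ω | TrapNoRSW₃ M c z k₀ K ω} ↑(trapScalesFinset₂ z k₀ K \ (trapDomain M).lower c z) := by
  classical
  rw [determinedBy_iff]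
  suffices h : ∀ ω₁ ω₂ : Set (Site 2),
      ω₁ ∩ ↑(trapScalesFinset₂ z k₀ K \ (trapDomain M).lower c z) = ω₂ ∩ ↑(trapScalesFinset₂ z k₀ K \ (trapDomain M).lower c z) →
      TrapNoRSW₃ M c z k₀ K ω₁ → TrapNoRSW₃ M c z k₀ K ω₂ from
    fun ω₁ ω₂ hω => ⟨h ω₁ ω₂ hω, h ω₂ ω₁ hω.symm⟩
  intro ω₁ ω₂ hω h j hj ω' hagree hω'
  set A := triSqAnnulusFinset z (trapScale k₀ j) (31 * trapScale k₀ j) with hA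
  set ω'' : Set (Site 2) := {v | if v ∈ A then v ∈ ω' else v ∈ ω₁} with hω''
  have hA' : ω'' ∩ ↑A = ω' ∩ ↑A := by
    ext v
    simp only [hω'', Set.mem_inter_iff, Set.mem_setOf_eq, Finset.mem_coe]
    constructor
    · rintro ⟨h1, h2⟩; rw [if_pos h2] at h1; exact ⟨h1, h2⟩
    · rintro ⟨h1, h2⟩; rw [if_pos h2]; exact ⟨h1, h2⟩
  have hmem : ω'' ∈ trapRSW₃ z (trapScale k₀ j) :=
    ((determinedBy_iff _ _).1 (determinedBy_trapRSW₃ z (trapScale k₀ j)) ω'' ω' hA').2 hω'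
  refine h j hj ω'' (fun v hv => ?_) hmem
  simp only [hω'', Set.mem_setOf_eq]
  split_ifs with hvA
  · rw [hagree v hv]
    have : v ∈ (↑(trapScalesFinset₂ z k₀ K \ (trapDomain M).lower c z) : Set (Site 2)) := by
      rw [Finset.coe_sdiff]
      refine ⟨Finset.mem_coe.2 ?_, hv⟩
      rw [trapScalesFinset₂, Finset.mem_biUnion]
      exact ⟨j, Finset.mem_range.2 hj, hvA⟩
    have key := Set.ext_iff.1 hω v
    simp only [Set.mem_inter_iff] at key
    constructor
    · intro h2; exact (key.2 ⟨h2, this⟩).1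
    · intro h1; exact (key.1 ⟨h1, this⟩).1
  · exact Iff.rfl

/-- On `{lowestSeq u = (c, z)}`, failure with both exclusions on all scales forces `TrapNoRSW₃`
(`16 k_{j} + 1 ≤ M`). [cite: Nolin2008, §4.4 Lemma 15 (proof) (arXiv 0711.4948: Lemma 14)] -/
theorem trapNoRSW₃_of_fail {M u k₀ K : ℕ} (hk₀ : 1 ≤ k₀) (hKM : ∀ j < K, 16 * (trapScale k₀ j : ℤ) + 1 ≤ M)
    {ω : SiteConfig (Site 2)} {c : Finset (Site 2)} {z : Site 2} (h : (trapDomain M).lowestSeq ω u = some (c, z))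
    (hfail : ∀ j < K, ¬ TrapFenceOK₃ M c z (trapScale k₀ j) ω) : TrapNoRSW₃ M c z k₀ K ω := by
  intro j hj ω' hagree hω'
  obtain ⟨hc, hcω⟩ := JDomain.isCrossing_of_lowestSeq h
  exact hfail j hj (trapFenceOK₃_of_mem_trapRSW₃ (one_le_trapScale hk₀ j) (hKM j hj) hc hcω hagree hω')

/-- `TrapNoRSW₃ ⊆ ⋂_j (trapRSW₃ z k_j)ᶜ` (take `ω' = ω`). [folklore] -/
theorem trapNoRSW₃_subset (M : ℕ) (c : Finset (Site 2)) (z : Site 2) (k₀ K : ℕ) :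
    {ω | TrapNoRSW₃ M c z k₀ K ω} ⊆ ⋂ j ∈ Finset.range K, (trapRSW₃ z (trapScale k₀ j))ᶜ := by
  intro ω hω
  simp only [Set.mem_iInter, Set.mem_compl_iff]
  intro j hj
  exact hω j (Finset.mem_range.1 hj) ω (fun v _ => Iff.rfl)

/-- **The union bound over the values of the `u`-th lowest crossing, with both exclusions, at density
`p`** (Nolin 2008, (4.18)–(4.19)): if all open frames of scales `k < M` have `P_p ≥ c_F` and all
closed rings of scales `1 ≤ k`, `32 k < M` have `P_p ≥ c_E`, then
`P_p(TrapSeqFail₃ M u k₀ K) ≤ P_p(lowestSeq u ≠ none) · (1 - c_F² c_E)^K` (`32 k_j + 1 ≤ M` for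
`j < K`). Proof verbatim that of `real_trapSeqFail_le_at`. [cite: Nolin2008, §4.4 Lemma 15 (proof) (arXiv 0711.4948: Lemma 14, (4.19)), with Thm. 11 "uniformly in p"] -/
theorem real_trapSeqFail₃_le_at (p : unitInterval) {cF cE cI : ℝ} (hcF : 0 < cF) (hcF1 : cF ≤ 1) (hcE : 0 ≤ cE)
    (hcE1 : cE ≤ 1) (hcI : 0 ≤ cI) (hcI1 : cI ≤ 1) {M : ℕ}
    (hF : ∀ (z : Site 2) (k : ℕ), 1 ≤ k → k < M → cF ≤ (triSitePercolation p).real (triFrameAt z k))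
    (hEr : ∀ (z : Site 2) (k : ℕ), 1 ≤ k → 32 * k < M → cE ≤ (triSitePercolation p).real (compl ⁻¹' triRingAt z k))
    (hIr : ∀ (z : Site 2) (k : ℕ), 1 ≤ k → 32 * k < M → cI ≤ (triSitePercolation p).real (compl ⁻¹' triInnerRingAt z k))
    {u k₀ K : ℕ} (hM : 1 ≤ M) (hk₀ : 1 ≤ k₀) (hKM : ∀ j < K, 32 * (trapScale k₀ j : ℤ) + 1 ≤ M) :
    (triSitePercolation p).real {ω | TrapSeqFail₃ M u k₀ K ω} ≤
      (triSitePercolation p).real {ω | (trapDomain M).lowestSeq ω u ≠ none} * (1 - cF ^ 2 * cE * cI) ^ K := by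
  classical
  have hcut := trapDomain_cutProp M
  have hdual := trapDomain_dualProp hM
  have hKS : ∀ j < K, 8 * trapScale k₀ j < M := fun j hj => by have := hKM j hj; omega
  have hKS' : ∀ j < K, trapScale k₀ j < (M - 1) / 32 + 1 := fun j hj => by have := hKM j hj; omega
  have hKM' : ∀ j < K, 16 * (trapScale k₀ j : ℤ) + 1 ≤ M := fun j hj => by have := hKM j hj; omega
  have hEr' : ∀ (z : Site 2) (k : ℕ), 1 ≤ k → k < (M - 1) / 32 + 1 → cE ≤ (triSitePercolation p).real (compl ⁻¹' triRingAt z k) :=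
    fun z k hk hkS => hEr z k hk (by omega)
  have hIr' : ∀ (z : Site 2) (k : ℕ), 1 ≤ k → k < (M - 1) / 32 + 1 → cI ≤ (triSitePercolation p).real (compl ⁻¹' triInnerRingAt z k) :=
    fun z k hk hkS => hIr z k hk (by omega)
  set μ := triSitePercolation p with hμ
  set E : Finset (Site 2) × Site 2 → Set (SiteConfig (Site 2)) :=
    fun q => {ω | (trapDomain M).lowestSeq ω u = some q} with hE
  have hsub : {ω | TrapSeqFail₃ M u k₀ K ω} ⊆ ⋃ q ∈ trapPairs M, (E q ∩ {ω | TrapNoRSW₃ M q.1 q.2 k₀ K ω}) := by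
    rintro ω ⟨c, z, h, hfail⟩
    simp only [Set.mem_iUnion, Set.mem_inter_iff, Set.mem_setOf_eq]
    exact ⟨(c, z), mem_trapPairs_of_lowestSeq h, h, trapNoRSW₃_of_fail hk₀ hKM' h hfail⟩
  have hterm : ∀ q ∈ trapPairs M, μ.real (E q ∩ {ω | TrapNoRSW₃ M q.1 q.2 k₀ K ω}) ≤ μ.real (E q) * (1 - cF ^ 2 * cE * cI) ^ K := by
    rintro ⟨c, z⟩ -
    have hEdet : DeterminedBy (E (c, z)) ↑((trapDomain M).lower c z) :=
      JDomain.determinedBy_lowestSeq_eq hcut hdual u c z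
    have hNdet := determinedBy_trapNoRSW₃ M c z k₀ K
    have hdisj : Disjoint ((trapDomain M).lower c z) (trapScalesFinset₂ z k₀ K \ (trapDomain M).lower c z) :=
      Finset.disjoint_sdiff
    rw [hμ]
    unfold triSitePercolation
    rw [sitePercolation_real_inter_of_disjoint p hEdet hNdet hdisj]
    refine mul_le_mul_of_nonneg_left ?_ measureReal_nonneg
    have h1 := (real_iInter_compl_trapRSW₃_le_at p hcF hcE hcI hF hEr' hIr' z hk₀ K hKS hKS').1
    unfold triSitePercolation at h1
    exact (measureReal_mono (trapNoRSW₃_subset M c z k₀ K)).trans h1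
  have hmeas : ∀ q ∈ trapPairs M, MeasurableSet (E q) := fun q _ =>
    (JDomain.determinedBy_lowestSeq_eq hcut hdual u q.1 q.2).measurableSet_of_finset
  have hdisjE : (↑(trapPairs M) : Set (Finset (Site 2) × Site 2)).PairwiseDisjoint E := fun q _ q' _ hqq' =>
    JDomain.disjoint_setOf_lowestSeq_eq hqq'
  have hunion : μ.real (⋃ q ∈ trapPairs M, E q) ≤ μ.real {ω | (trapDomain M).lowestSeq ω u ≠ none} := by
    refine measureReal_mono ?_
    intro ω hω
    simp only [Set.mem_iUnion, Set.mem_setOf_eq] at hω ⊢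
    obtain ⟨q, -, hq⟩ := hω
    rw [hq]; exact Option.some_ne_none q
  have h0 : 0 ≤ 1 - cF ^ 2 * cE * cI := by
    have h1 : cF ^ 2 ≤ 1 := pow_le_one₀ hcF.le hcF1
    have h2 : cF ^ 2 * cE * cI ≤ 1 := by
      calc cF ^ 2 * cE * cI ≤ 1 * 1 * 1 := by gcongr
        _ = 1 := by ring
    linarith
  calc μ.real {ω | TrapSeqFail₃ M u k₀ K ω}
      ≤ μ.real (⋃ q ∈ trapPairs M, (E q ∩ {ω | TrapNoRSW₃ M q.1 q.2 k₀ K ω})) :=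
        measureReal_mono hsub (measure_ne_top _ _)
    _ ≤ ∑ q ∈ trapPairs M, μ.real (E q ∩ {ω | TrapNoRSW₃ M q.1 q.2 k₀ K ω}) := measureReal_biUnion_finset_le _ _
    _ ≤ ∑ q ∈ trapPairs M, μ.real (E q) * (1 - cF ^ 2 * cE * cI) ^ K := Finset.sum_le_sum hterm
    _ = (∑ q ∈ trapPairs M, μ.real (E q)) * (1 - cF ^ 2 * cE * cI) ^ K := (Finset.sum_mul _ _ _).symm
    _ = μ.real (⋃ q ∈ trapPairs M, E q) * (1 - cF ^ 2 * cE * cI) ^ K := by rw [measureReal_biUnion_finset hdisjE hmeas]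
    _ ≤ μ.real {ω | (trapDomain M).lowestSeq ω u ≠ none} * (1 - cF ^ 2 * cE * cI) ^ K :=
        mul_le_mul_of_nonneg_right hunion (pow_nonneg h0 K)

end Literature.Probability.Percolation
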